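import Summits.CriticalPhenomena.PercolationContinuityZ3.Theorems.PercNearOneGluingNoHeavyLowerTailSahiTangentCylinderFourPairs

/-!
# `NoHeavyLowerTail` (crux stmt-CriticalPhenomena-4575), Sahi programme: **THE ORDER-4 CONTRACTION INEQUALITY FOR CYLINDER PAIRS ON EVERY CUBE —
# part 3: frozen configurations and the induction on `excess4`** (`D4cyl_nonneg`)

Support file (Sahi cell, seat `prim-sahi-p1`, generation 49; `--supports stmt-CriticalPhenomena-4575`).  Pure proofs, standard axioms, no `sorry`;
no definitions (the termination measure `excess4` is defined in part 2).  Part 1 (`…CylinderFourPoly`): real inequalities; part 2 (`…CylinderFourPairs`): `D4cyl` and the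
erasure steps; part 4 (`…CylinderFourBridge`): the `sahiE` statement for `bernoulliWeight`.

THE RESULT (`D4cyl_nonneg`).  For every cube `{0,1}^ι`, every `p : ι → [0,1]`, `s ∈ [0,1]` and cylinder pairs `t_l ⊆ b_l` (`l < 4`): given `E₄ ≥ 0`
for the four top cylinders, `Δ₄(s) = D4cyl p s t b ≥ 0`.  FROZEN CASE (`D4cyl_nonneg_of_frozen`): when every defect `b_l ∖ t_l` misses the other
bottoms, each bottom splits as `b_l = t_l ⊔ d_l` with the `d_l` pairwise disjoint and off all tops, so `M(∪_{l∈S} b_l) = M(∪_{l∈S} t_l)·∏_{l∈S} M(d_l)`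
and part 1's `frozen4_nonneg` (multilinear interpolation over the sixteen vertices) applies.  INDUCTION: a non-frozen configuration has a defect
coordinate lying in another bottom; erasing it lowers `Δ₄` (part 2) and `excess4`. [this work]
-/

namespace Summit.CriticalPhenomena.PercolationContinuityZ3.Theorems.SahiTangentCyl

open Finset
open scoped BigOperators

noncomputable section

variable {ι : Type*} [DecidableEq ι] {p : ι → ℝ}

variable [Fintype ι]

/-! ### Frozen configurations -/

omit [Fintype ι] in
/-- **Frozen configurations**: if each defect `b_l ∖ t_l` misses the other three bottoms then `Δ₄(s) ≥ 0` (given `E₄ ≥ 0` for the top cylinders).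
[this work] -/
theorem D4cyl_nonneg_of_frozen (hp0 : ∀ e, 0 ≤ p e) (hp1 : ∀ e, p e ≤ 1) {s : ℝ} (hs0 : 0 ≤ s) (hs1 : s ≤ 1)
    {t b : Fin 4 → Finset ι} (htb : ∀ l, t l ⊆ b l)
    (hE4 : 0 ≤ 6 * cylMass p (t 0 ∪ t 1 ∪ t 2 ∪ t 3) - 2 * cylMass p (t 0) * cylMass p (t 1 ∪ t 2 ∪ t 3) - cylMass p (t 0 ∪ t 1) * cylMass p (t 2 ∪ t 3) - 2 * cylMass p (t 1) * cylMass p (t 0 ∪ t 2 ∪ t 3) + cylMass p (t 0) * cylMass p (t 1) * cylMass p (t 2 ∪ t 3) - 2 * cylMass p (t 3) * cylMass p (t 0 ∪ t 1 ∪ t 2) - cylMass p (t 0 ∪ t 3) * cylMass p (t 1 ∪ t 2) + cylMass p (t 0) * cylMass p (t 3) * cylMass p (t 1 ∪ t 2) - cylMass p (t 0 ∪ t 2) * cylMass p (t 1 ∪ t 3) - 2 * cylMass p (t 2) * cylMass p (t 0 ∪ t 1 ∪ t 3) + cylMass p (t 0) * cylMass p (t 2) * cylMass p (t 1 ∪ t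 3) + cylMass p (t 2) * cylMass p (t 3) * cylMass p (t 0 ∪ t 1) + cylMass p (t 1) * cylMass p (t 3) * cylMass p (t 0 ∪ t 2) + cylMass p (t 1) * cylMass p (t 2) * cylMass p (t 0 ∪ t 3) - cylMass p (t 0) * cylMass p (t 1) * cylMass p (t 2) * cylMass p (t 3))
    (hf0 : (b 0 \ t 0) ∩ (b 1 ∪ b 2 ∪ b 3) = ∅) (hf1 : (b 1 \ t 1) ∩ (b 0 ∪ b 2 ∪ b 3) = ∅) (hf2 : (b 2 \ t 2) ∩ (b 0 ∪ b 1 ∪ b 3) = ∅) (hf3 : (b 3 \ t 3) ∩ (b 0 ∪ b 1 ∪ b 2) = ∅) :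
    0 ≤ D4cyl p s t b := by
  -- each bottom splits into its top and its defect
  have hb0 : b 0 = t 0 ∪ (b 0 \ t 0) := (union_sdiff_of_subset (htb 0)).symm
  have hb1 : b 1 = t 1 ∪ (b 1 \ t 1) := (union_sdiff_of_subset (htb 1)).symm
  have hb2 : b 2 = t 2 ∪ (b 2 \ t 2) := (union_sdiff_of_subset (htb 2)).symm
  have hb3 : b 3 = t 3 ∪ (b 3 \ t 3) := (union_sdiff_of_subset (htb 3)).symm
  -- disjointness bookkeeping
  have hf0' : Disjoint (b 0 \ t 0) (b 1 ∪ b 2 ∪ b 3) := disjoint_iff_inter_eq_empty.2 hf0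
  have hf1' : Disjoint (b 1 \ t 1) (b 0 ∪ b 2 ∪ b 3) := disjoint_iff_inter_eq_empty.2 hf1
  have hf2' : Disjoint (b 2 \ t 2) (b 0 ∪ b 1 ∪ b 3) := disjoint_iff_inter_eq_empty.2 hf2
  have hf3' : Disjoint (b 3 \ t 3) (b 0 ∪ b 1 ∪ b 2) := disjoint_iff_inter_eq_empty.2 hf3
  have dt00 : Disjoint (t 0) (b 0 \ t 0) := disjoint_sdiff
  have dt10 : Disjoint (t 1) (b 0 \ t 0) := (hf0'.mono_right ((htb 1).trans ((subset_union_left).trans subset_union_left))).symm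
  have dt20 : Disjoint (t 2) (b 0 \ t 0) := (hf0'.mono_right ((htb 2).trans ((subset_union_right).trans subset_union_left))).symm
  have dt30 : Disjoint (t 3) (b 0 \ t 0) := (hf0'.mono_right ((htb 3).trans (subset_union_right))).symm
  have dt01 : Disjoint (t 0) (b 1 \ t 1) := (hf1'.mono_right ((htb 0).trans ((subset_union_left).trans subset_union_left))).symm
  have dt11 : Disjoint (t 1) (b 1 \ t 1) := disjoint_sdiff
  have dt21 : Disjoint (t 2) (b 1 \ t 1) := (hf1'.mono_right ((htb 2).trans ((subset_union_right).trans subset_union_left))).symm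
  have dt31 : Disjoint (t 3) (b 1 \ t 1) := (hf1'.mono_right ((htb 3).trans (subset_union_right))).symm
  have dt02 : Disjoint (t 0) (b 2 \ t 2) := (hf2'.mono_right ((htb 0).trans ((subset_union_left).trans subset_union_left))).symm
  have dt12 : Disjoint (t 1) (b 2 \ t 2) := (hf2'.mono_right ((htb 1).trans ((subset_union_right).trans subset_union_left))).symm
  have dt22 : Disjoint (t 2) (b 2 \ t 2) := disjoint_sdiff
  have dt32 : Disjoint (t 3) (b 2 \ t 2) := (hf2'.mono_right ((htb 3).trans (subset_union_right))).symm
  have dt03 : Disjoint (t 0) (b 3 \ t 3) := (hf3'.mono_right ((htb 0).trans ((subset_union_left).trans subset_union_left))).symm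
  have dt13 : Disjoint (t 1) (b 3 \ t 3) := (hf3'.mono_right ((htb 1).trans ((subset_union_right).trans subset_union_left))).symm
  have dt23 : Disjoint (t 2) (b 3 \ t 3) := (hf3'.mono_right ((htb 2).trans (subset_union_right))).symm
  have dt33 : Disjoint (t 3) (b 3 \ t 3) := disjoint_sdiff
  have dd01 : Disjoint (b 0 \ t 0) (b 1 \ t 1) := hf0'.mono_right (sdiff_subset.trans ((subset_union_left).trans subset_union_left))
  have dd02 : Disjoint (b 0 \ t 0) (b 2 \ t 2) := hf0'.mono_right (sdiff_subset.trans ((subset_union_right).trans subset_union_left))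
  have dd03 : Disjoint (b 0 \ t 0) (b 3 \ t 3) := hf0'.mono_right (sdiff_subset.trans (subset_union_right))
  have dd12 : Disjoint (b 1 \ t 1) (b 2 \ t 2) := hf1'.mono_right (sdiff_subset.trans ((subset_union_right).trans subset_union_left))
  have dd13 : Disjoint (b 1 \ t 1) (b 3 \ t 3) := hf1'.mono_right (sdiff_subset.trans (subset_union_right))
  have dd23 : Disjoint (b 2 \ t 2) (b 3 \ t 3) := hf2'.mono_right (sdiff_subset.trans (subset_union_right))
  have Y0 : cylMass p (b 0) = cylMass p (t 0) * cylMass p (b 0 \ t 0) := by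
    rw [← cylMass_union_of_disjoint disjoint_sdiff, union_sdiff_of_subset (htb 0)]
  have Y1 : cylMass p (b 1) = cylMass p (t 1) * cylMass p (b 1 \ t 1) := by
    rw [← cylMass_union_of_disjoint disjoint_sdiff, union_sdiff_of_subset (htb 1)]
  have Y2 : cylMass p (b 2) = cylMass p (t 2) * cylMass p (b 2 \ t 2) := by
    rw [← cylMass_union_of_disjoint disjoint_sdiff, union_sdiff_of_subset (htb 2)]
  have Y3 : cylMass p (b 3) = cylMass p (t 3) * cylMass p (b 3 \ t 3) := by
    rw [← cylMass_union_of_disjoint disjoint_sdiff, union_sdiff_of_subset (htb 3)]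
  have e01 : b 0 ∪ b 1 = (t 0 ∪ t 1) ∪ ((b 0 \ t 0) ∪ (b 1 \ t 1)) := by
    conv_lhs => rw [hb0, hb1]
    ac_rfl
  have Y01 : cylMass p (b 0 ∪ b 1) = cylMass p (t 0 ∪ t 1) * (cylMass p (b 0 \ t 0) * cylMass p (b 1 \ t 1)) := by
    rw [e01, cylMass_union_of_disjoint (disjoint_union_left.2 ⟨(disjoint_union_right.2 ⟨dt00, dt01⟩), (disjoint_union_right.2 ⟨dt10, dt11⟩)⟩), cylMass_union_of_disjoint dd01]
  have e02 : b 0 ∪ b 2 = (t 0 ∪ t 2) ∪ ((b 0 \ t 0) ∪ (b 2 \ t 2)) := by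
    conv_lhs => rw [hb0, hb2]
    ac_rfl
  have Y02 : cylMass p (b 0 ∪ b 2) = cylMass p (t 0 ∪ t 2) * (cylMass p (b 0 \ t 0) * cylMass p (b 2 \ t 2)) := by
    rw [e02, cylMass_union_of_disjoint (disjoint_union_left.2 ⟨(disjoint_union_right.2 ⟨dt00, dt02⟩), (disjoint_union_right.2 ⟨dt20, dt22⟩)⟩), cylMass_union_of_disjoint dd02]
  have e03 : b 0 ∪ b 3 = (t 0 ∪ t 3) ∪ ((b 0 \ t 0) ∪ (b 3 \ t 3)) := by
    conv_lhs => rw [hb0, hb3]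
    ac_rfl
  have Y03 : cylMass p (b 0 ∪ b 3) = cylMass p (t 0 ∪ t 3) * (cylMass p (b 0 \ t 0) * cylMass p (b 3 \ t 3)) := by
    rw [e03, cylMass_union_of_disjoint (disjoint_union_left.2 ⟨(disjoint_union_right.2 ⟨dt00, dt03⟩), (disjoint_union_right.2 ⟨dt30, dt33⟩)⟩), cylMass_union_of_disjoint dd03]
  have e12 : b 1 ∪ b 2 = (t 1 ∪ t 2) ∪ ((b 1 \ t 1) ∪ (b 2 \ t 2)) := by
    conv_lhs => rw [hb1, hb2]
    ac_rfl
  have Y12 : cylMass p (b 1 ∪ b 2) = cylMass p (t 1 ∪ t 2) * (cylMass p (b 1 \ t 1) * cylMass p (b 2 \ t 2)) := by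
    rw [e12, cylMass_union_of_disjoint (disjoint_union_left.2 ⟨(disjoint_union_right.2 ⟨dt11, dt12⟩), (disjoint_union_right.2 ⟨dt21, dt22⟩)⟩), cylMass_union_of_disjoint dd12]
  have e13 : b 1 ∪ b 3 = (t 1 ∪ t 3) ∪ ((b 1 \ t 1) ∪ (b 3 \ t 3)) := by
    conv_lhs => rw [hb1, hb3]
    ac_rfl
  have Y13 : cylMass p (b 1 ∪ b 3) = cylMass p (t 1 ∪ t 3) * (cylMass p (b 1 \ t 1) * cylMass p (b 3 \ t 3)) := by
    rw [e13, cylMass_union_of_disjoint (disjoint_union_left.2 ⟨(disjoint_union_right.2 ⟨dt11, dt13⟩), (disjoint_union_right.2 ⟨dt31, dt33⟩)⟩), cylMass_union_of_disjoint dd13]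
  have e23 : b 2 ∪ b 3 = (t 2 ∪ t 3) ∪ ((b 2 \ t 2) ∪ (b 3 \ t 3)) := by
    conv_lhs => rw [hb2, hb3]
    ac_rfl
  have Y23 : cylMass p (b 2 ∪ b 3) = cylMass p (t 2 ∪ t 3) * (cylMass p (b 2 \ t 2) * cylMass p (b 3 \ t 3)) := by
    rw [e23, cylMass_union_of_disjoint (disjoint_union_left.2 ⟨(disjoint_union_right.2 ⟨dt22, dt23⟩), (disjoint_union_right.2 ⟨dt32, dt33⟩)⟩), cylMass_union_of_disjoint dd23]
  have e012 : b 0 ∪ b 1 ∪ b 2 = (t 0 ∪ t 1 ∪ t 2) ∪ ((b 0 \ t 0) ∪ (b 1 \ t 1) ∪ (b 2 \ t 2)) := by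
    conv_lhs => rw [hb0, hb1, hb2]
    ac_rfl
  have Y012 : cylMass p (b 0 ∪ b 1 ∪ b 2) = cylMass p (t 0 ∪ t 1 ∪ t 2) * (cylMass p (b 0 \ t 0) * cylMass p (b 1 \ t 1) * cylMass p (b 2 \ t 2)) := by
    rw [e012, cylMass_union_of_disjoint (disjoint_union_left.2 ⟨(disjoint_union_left.2 ⟨(disjoint_union_right.2 ⟨(disjoint_union_right.2 ⟨dt00, dt01⟩), dt02⟩), (disjoint_union_right.2 ⟨(disjoint_union_right.2 ⟨dt10, dt11⟩), dt12⟩)⟩), (disjoint_union_right.2 ⟨(disjoint_union_right.2 ⟨dt20, dt21⟩), dt22⟩)⟩), cylMass_union_of_disjoint (disjoint_union_left.2 ⟨dd02, dd12⟩), cylMass_union_of_disjoint dd01]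
  have e013 : b 0 ∪ b 1 ∪ b 3 = (t 0 ∪ t 1 ∪ t 3) ∪ ((b 0 \ t 0) ∪ (b 1 \ t 1) ∪ (b 3 \ t 3)) := by
    conv_lhs => rw [hb0, hb1, hb3]
    ac_rfl
  have Y013 : cylMass p (b 0 ∪ b 1 ∪ b 3) = cylMass p (t 0 ∪ t 1 ∪ t 3) * (cylMass p (b 0 \ t 0) * cylMass p (b 1 \ t 1) * cylMass p (b 3 \ t 3)) := by
    rw [e013, cylMass_union_of_disjoint (disjoint_union_left.2 ⟨(disjoint_union_left.2 ⟨(disjoint_union_right.2 ⟨(disjoint_union_right.2 ⟨dt00, dt01⟩), dt03⟩), (disjoint_union_right.2 ⟨(disjoint_union_right.2 ⟨dt10, dt11⟩), dt13⟩)⟩), (disjoint_union_right.2 ⟨(disjoint_union_right.2 ⟨dt30, dt31⟩), dt33⟩)⟩), cylMass_union_of_disjoint (disjoint_union_left.2 ⟨dd03, dd13⟩), cylMass_union_of_disjoint dd01]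
  have e023 : b 0 ∪ b 2 ∪ b 3 = (t 0 ∪ t 2 ∪ t 3) ∪ ((b 0 \ t 0) ∪ (b 2 \ t 2) ∪ (b 3 \ t 3)) := by
    conv_lhs => rw [hb0, hb2, hb3]
    ac_rfl
  have Y023 : cylMass p (b 0 ∪ b 2 ∪ b 3) = cylMass p (t 0 ∪ t 2 ∪ t 3) * (cylMass p (b 0 \ t 0) * cylMass p (b 2 \ t 2) * cylMass p (b 3 \ t 3)) := by
    rw [e023, cylMass_union_of_disjoint (disjoint_union_left.2 ⟨(disjoint_union_left.2 ⟨(disjoint_union_right.2 ⟨(disjoint_union_right.2 ⟨dt00, dt02⟩), dt03⟩), (disjoint_union_right.2 ⟨(disjoint_union_right.2 ⟨dt20, dt22⟩), dt23⟩)⟩), (disjoint_union_right.2 ⟨(disjoint_union_right.2 ⟨dt30, dt32⟩), dt33⟩)⟩), cylMass_union_of_disjoint (disjoint_union_left.2 ⟨dd03, dd23⟩), cylMass_union_of_disjoint dd02]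
  have e123 : b 1 ∪ b 2 ∪ b 3 = (t 1 ∪ t 2 ∪ t 3) ∪ ((b 1 \ t 1) ∪ (b 2 \ t 2) ∪ (b 3 \ t 3)) := by
    conv_lhs => rw [hb1, hb2, hb3]
    ac_rfl
  have Y123 : cylMass p (b 1 ∪ b 2 ∪ b 3) = cylMass p (t 1 ∪ t 2 ∪ t 3) * (cylMass p (b 1 \ t 1) * cylMass p (b 2 \ t 2) * cylMass p (b 3 \ t 3)) := by
    rw [e123, cylMass_union_of_disjoint (disjoint_union_left.2 ⟨(disjoint_union_left.2 ⟨(disjoint_union_right.2 ⟨(disjoint_union_right.2 ⟨dt11, dt12⟩), dt13⟩), (disjoint_union_right.2 ⟨(disjoint_union_right.2 ⟨dt21, dt22⟩), dt23⟩)⟩), (disjoint_union_right.2 ⟨(disjoint_union_right.2 ⟨dt31, dt32⟩), dt33⟩)⟩), cylMass_union_of_disjoint (disjoint_union_left.2 ⟨dd13, dd23⟩), cylMass_union_of_disjoint dd12]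
  have e0123 : b 0 ∪ b 1 ∪ b 2 ∪ b 3 = (t 0 ∪ t 1 ∪ t 2 ∪ t 3) ∪ ((b 0 \ t 0) ∪ (b 1 \ t 1) ∪ (b 2 \ t 2) ∪ (b 3 \ t 3)) := by
    conv_lhs => rw [hb0, hb1, hb2, hb3]
    ac_rfl
  have Y0123 : cylMass p (b 0 ∪ b 1 ∪ b 2 ∪ b 3) = cylMass p (t 0 ∪ t 1 ∪ t 2 ∪ t 3) * (cylMass p (b 0 \ t 0) * cylMass p (b 1 \ t 1) * cylMass p (b 2 \ t 2) * cylMass p (b 3 \ t 3)) := by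
    rw [e0123, cylMass_union_of_disjoint (disjoint_union_left.2 ⟨(disjoint_union_left.2 ⟨(disjoint_union_left.2 ⟨(disjoint_union_right.2 ⟨(disjoint_union_right.2 ⟨(disjoint_union_right.2 ⟨dt00, dt01⟩), dt02⟩), dt03⟩), (disjoint_union_right.2 ⟨(disjoint_union_right.2 ⟨(disjoint_union_right.2 ⟨dt10, dt11⟩), dt12⟩), dt13⟩)⟩), (disjoint_union_right.2 ⟨(disjoint_union_right.2 ⟨(disjoint_union_right.2 ⟨dt20, dt21⟩), dt22⟩), dt23⟩)⟩), (disjoint_union_right.2 ⟨(disjoint_union_right.2 ⟨(disjoint_union_right.2 ⟨dt30, dt31⟩), dt32⟩), dt33⟩)⟩), cylMass_union_of_disjoint (disjoint_union_left.2 ⟨(disjoint_union_left.2 ⟨dd03, dd13⟩), dd23⟩), cylMass_union_of_disjoint (disjoint_union_left.2 ⟨dd02, dd12⟩), cylMass_union_of_disjoint dd01]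
  have h_0_1 : cylMass p (t 0) * cylMass p (t 1) ≤ cylMass p (t 0 ∪ t 1) := by
    have hu : t 0 ∪ (t 1) = t 0 ∪ t 1 := by ac_rfl
    rw [← hu]; exact cylMass_mul_le_union hp0 hp1 _ _
  have h_01_2 : cylMass p (t 0 ∪ t 1) * cylMass p (t 2) ≤ cylMass p (t 0 ∪ t 1 ∪ t 2) := by
    have hu : t 0 ∪ t 1 ∪ (t 2) = t 0 ∪ t 1 ∪ t 2 := by ac_rfl
    rw [← hu]; exact cylMass_mul_le_union hp0 hp1 _ _
  have h_02_1 : cylMass p (t 0 ∪ t 2) * cylMass p (t 1) ≤ cylMass p (t 0 ∪ t 1 ∪ t 2) := by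
    have hu : t 0 ∪ t 2 ∪ (t 1) = t 0 ∪ t 1 ∪ t 2 := by ac_rfl
    rw [← hu]; exact cylMass_mul_le_union hp0 hp1 _ _
  have h_0_12 : cylMass p (t 0) * cylMass p (t 1 ∪ t 2) ≤ cylMass p (t 0 ∪ t 1 ∪ t 2) := by
    have hu : t 0 ∪ (t 1 ∪ t 2) = t 0 ∪ t 1 ∪ t 2 := by ac_rfl
    rw [← hu]; exact cylMass_mul_le_union hp0 hp1 _ _
  have h_01_3 : cylMass p (t 0 ∪ t 1) * cylMass p (t 3) ≤ cylMass p (t 0 ∪ t 1 ∪ t 3) := by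
    have hu : t 0 ∪ t 1 ∪ (t 3) = t 0 ∪ t 1 ∪ t 3 := by ac_rfl
    rw [← hu]; exact cylMass_mul_le_union hp0 hp1 _ _
  have h_03_1 : cylMass p (t 0 ∪ t 3) * cylMass p (t 1) ≤ cylMass p (t 0 ∪ t 1 ∪ t 3) := by
    have hu : t 0 ∪ t 3 ∪ (t 1) = t 0 ∪ t 1 ∪ t 3 := by ac_rfl
    rw [← hu]; exact cylMass_mul_le_union hp0 hp1 _ _
  have h_0_13 : cylMass p (t 0) * cylMass p (t 1 ∪ t 3) ≤ cylMass p (t 0 ∪ t 1 ∪ t 3) := by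
    have hu : t 0 ∪ (t 1 ∪ t 3) = t 0 ∪ t 1 ∪ t 3 := by ac_rfl
    rw [← hu]; exact cylMass_mul_le_union hp0 hp1 _ _
  have h_0_2 : cylMass p (t 0) * cylMass p (t 2) ≤ cylMass p (t 0 ∪ t 2) := by
    have hu : t 0 ∪ (t 2) = t 0 ∪ t 2 := by ac_rfl
    rw [← hu]; exact cylMass_mul_le_union hp0 hp1 _ _
  have h_02_3 : cylMass p (t 0 ∪ t 2) * cylMass p (t 3) ≤ cylMass p (t 0 ∪ t 2 ∪ t 3) := by
    have hu : t 0 ∪ t 2 ∪ (t 3) = t 0 ∪ t 2 ∪ t 3 := by ac_rfl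
    rw [← hu]; exact cylMass_mul_le_union hp0 hp1 _ _
  have h_03_2 : cylMass p (t 0 ∪ t 3) * cylMass p (t 2) ≤ cylMass p (t 0 ∪ t 2 ∪ t 3) := by
    have hu : t 0 ∪ t 3 ∪ (t 2) = t 0 ∪ t 2 ∪ t 3 := by ac_rfl
    rw [← hu]; exact cylMass_mul_le_union hp0 hp1 _ _
  have h_0_23 : cylMass p (t 0) * cylMass p (t 2 ∪ t 3) ≤ cylMass p (t 0 ∪ t 2 ∪ t 3) := by
    have hu : t 0 ∪ (t 2 ∪ t 3) = t 0 ∪ t 2 ∪ t 3 := by ac_rfl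
    rw [← hu]; exact cylMass_mul_le_union hp0 hp1 _ _
  have h_0_3 : cylMass p (t 0) * cylMass p (t 3) ≤ cylMass p (t 0 ∪ t 3) := by
    have hu : t 0 ∪ (t 3) = t 0 ∪ t 3 := by ac_rfl
    rw [← hu]; exact cylMass_mul_le_union hp0 hp1 _ _
  have h_1_2 : cylMass p (t 1) * cylMass p (t 2) ≤ cylMass p (t 1 ∪ t 2) := by
    have hu : t 1 ∪ (t 2) = t 1 ∪ t 2 := by ac_rfl
    rw [← hu]; exact cylMass_mul_le_union hp0 hp1 _ _
  have h_12_3 : cylMass p (t 1 ∪ t 2) * cylMass p (t 3) ≤ cylMass p (t 1 ∪ t 2 ∪ t 3) := by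
    have hu : t 1 ∪ t 2 ∪ (t 3) = t 1 ∪ t 2 ∪ t 3 := by ac_rfl
    rw [← hu]; exact cylMass_mul_le_union hp0 hp1 _ _
  have h_13_2 : cylMass p (t 1 ∪ t 3) * cylMass p (t 2) ≤ cylMass p (t 1 ∪ t 2 ∪ t 3) := by
    have hu : t 1 ∪ t 3 ∪ (t 2) = t 1 ∪ t 2 ∪ t 3 := by ac_rfl
    rw [← hu]; exact cylMass_mul_le_union hp0 hp1 _ _
  have h_1_23 : cylMass p (t 1) * cylMass p (t 2 ∪ t 3) ≤ cylMass p (t 1 ∪ t 2 ∪ t 3) := by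
    have hu : t 1 ∪ (t 2 ∪ t 3) = t 1 ∪ t 2 ∪ t 3 := by ac_rfl
    rw [← hu]; exact cylMass_mul_le_union hp0 hp1 _ _
  have h_1_3 : cylMass p (t 1) * cylMass p (t 3) ≤ cylMass p (t 1 ∪ t 3) := by
    have hu : t 1 ∪ (t 3) = t 1 ∪ t 3 := by ac_rfl
    rw [← hu]; exact cylMass_mul_le_union hp0 hp1 _ _
  have h_2_3 : cylMass p (t 2) * cylMass p (t 3) ≤ cylMass p (t 2 ∪ t 3) := by
    have hu : t 2 ∪ (t 3) = t 2 ∪ t 3 := by ac_rfl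
    rw [← hu]; exact cylMass_mul_le_union hp0 hp1 _ _
  have key := frozen4_nonneg (s := s) hs0 hs1 (cylMass_nonneg hp0 (b 0 \ t 0)) (cylMass_le_one hp0 hp1 (b 0 \ t 0)) (cylMass_nonneg hp0 (b 1 \ t 1)) (cylMass_le_one hp0 hp1 (b 1 \ t 1)) (cylMass_nonneg hp0 (b 2 \ t 2)) (cylMass_le_one hp0 hp1 (b 2 \ t 2)) (cylMass_nonneg hp0 (b 3 \ t 3)) (cylMass_le_one hp0 hp1 (b 3 \ t 3))
    (cylMass_nonneg hp0 _) (cylMass_nonneg hp0 _) (cylMass_nonneg hp0 _) (cylMass_nonneg hp0 _) (cylMass_nonneg hp0 _) (cylMass_nonneg hp0 _) (cylMass_nonneg hp0 _) (cylMass_nonneg hp0 _) (cylMass_nonneg hp0 _) (cylMass_nonneg hp0 _) (cylMass_nonneg hp0 _) (cylMass_nonneg hp0 _)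
    h_0_1 h_01_2 h_02_1 h_0_12 h_01_3 h_03_1 h_0_13 h_0_2 h_02_3 h_03_2 h_0_23 h_0_3 h_1_2 h_12_3 h_13_2 h_1_23 h_1_3 h_2_3
    hE4 Y0 Y1 Y2 Y3 Y01 Y02 Y03 Y12 Y13 Y23 Y012 Y013 Y023 Y123 Y0123
  unfold D4cyl
  exact key

/-! ### The induction on `excess4` -/


omit [Fintype ι] in
/-- Erasing a removable coordinate from `b 0` decreases the measure. [this work] -/
theorem excess4_erase_lt₀ (t b : Fin 4 → Finset ι) {e : ι} (hel : e ∈ b 0) (het : e ∉ t 0) (he : e ∈ b 1 ∪ b 2 ∪ b 3) :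
    excess4 t (Function.update b 0 ((b 0).erase e)) < excess4 t b := by
  have n10 : (1 : Fin 4) ≠ 0 := by decide
  have n20 : (2 : Fin 4) ≠ 0 := by decide
  have n30 : (3 : Fin 4) ≠ 0 := by decide
  unfold excess4
  rw [Function.update_self, Function.update_of_ne n10, Function.update_of_ne n20, Function.update_of_ne n30]
  have hs : (b 0).erase e ⊆ b 0 := erase_subset e (b 0)
  have h0 : ((((b 0).erase e) \ t 0) ∩ (b 1 ∪ b 2 ∪ b 3)).card < ((b 0 \ t 0) ∩ (b 1 ∪ b 2 ∪ b 3)).card := by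
    apply card_lt_card
    refine ⟨inter_subset_inter (sdiff_subset_sdiff hs subset_rfl) subset_rfl, fun hcon => ?_⟩
    have hmem : e ∈ (b 0 \ t 0) ∩ (b 1 ∪ b 2 ∪ b 3) := mem_inter.2 ⟨mem_sdiff.2 ⟨hel, het⟩, he⟩
    have := mem_inter.1 (hcon hmem)
    exact ((mem_erase.1 (mem_sdiff.1 this.1).1).1) rfl
  have h1 : ((b 1 \ t 1) ∩ ((b 0).erase e ∪ b 2 ∪ b 3)).card ≤ ((b 1 \ t 1) ∩ (b 0 ∪ b 2 ∪ b 3)).card :=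
    card_le_card (inter_subset_inter subset_rfl (union_subset_union (union_subset_union hs subset_rfl) subset_rfl))
  have h2 : ((b 2 \ t 2) ∩ ((b 0).erase e ∪ b 1 ∪ b 3)).card ≤ ((b 2 \ t 2) ∩ (b 0 ∪ b 1 ∪ b 3)).card :=
    card_le_card (inter_subset_inter subset_rfl (union_subset_union (union_subset_union hs subset_rfl) subset_rfl))
  have h3 : ((b 3 \ t 3) ∩ ((b 0).erase e ∪ b 1 ∪ b 2)).card ≤ ((b 3 \ t 3) ∩ (b 0 ∪ b 1 ∪ b 2)).card :=
    card_le_card (inter_subset_inter subset_rfl (union_subset_union (union_subset_union hs subset_rfl) subset_rfl))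
  omega

omit [Fintype ι] in
/-- Erasing a removable coordinate from `b 1` decreases the measure. [this work] -/
theorem excess4_erase_lt₁ (t b : Fin 4 → Finset ι) {e : ι} (hel : e ∈ b 1) (het : e ∉ t 1) (he : e ∈ b 0 ∪ b 2 ∪ b 3) :
    excess4 t (Function.update b 1 ((b 1).erase e)) < excess4 t b := by
  have n01 : (0 : Fin 4) ≠ 1 := by decide
  have n21 : (2 : Fin 4) ≠ 1 := by decide
  have n31 : (3 : Fin 4) ≠ 1 := by decide
  unfold excess4
  rw [Function.update_self, Function.update_of_ne n01, Function.update_of_ne n21, Function.update_of_ne n31]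
  have hs : (b 1).erase e ⊆ b 1 := erase_subset e (b 1)
  have h1 : ((((b 1).erase e) \ t 1) ∩ (b 0 ∪ b 2 ∪ b 3)).card < ((b 1 \ t 1) ∩ (b 0 ∪ b 2 ∪ b 3)).card := by
    apply card_lt_card
    refine ⟨inter_subset_inter (sdiff_subset_sdiff hs subset_rfl) subset_rfl, fun hcon => ?_⟩
    have hmem : e ∈ (b 1 \ t 1) ∩ (b 0 ∪ b 2 ∪ b 3) := mem_inter.2 ⟨mem_sdiff.2 ⟨hel, het⟩, he⟩
    have := mem_inter.1 (hcon hmem)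
    exact ((mem_erase.1 (mem_sdiff.1 this.1).1).1) rfl
  have h0 : ((b 0 \ t 0) ∩ ((b 1).erase e ∪ b 2 ∪ b 3)).card ≤ ((b 0 \ t 0) ∩ (b 1 ∪ b 2 ∪ b 3)).card :=
    card_le_card (inter_subset_inter subset_rfl (union_subset_union (union_subset_union hs subset_rfl) subset_rfl))
  have h2 : ((b 2 \ t 2) ∩ (b 0 ∪ (b 1).erase e ∪ b 3)).card ≤ ((b 2 \ t 2) ∩ (b 0 ∪ b 1 ∪ b 3)).card :=
    card_le_card (inter_subset_inter subset_rfl (union_subset_union (union_subset_union subset_rfl hs) subset_rfl))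
  have h3 : ((b 3 \ t 3) ∩ (b 0 ∪ (b 1).erase e ∪ b 2)).card ≤ ((b 3 \ t 3) ∩ (b 0 ∪ b 1 ∪ b 2)).card :=
    card_le_card (inter_subset_inter subset_rfl (union_subset_union (union_subset_union subset_rfl hs) subset_rfl))
  omega

omit [Fintype ι] in
/-- Erasing a removable coordinate from `b 2` decreases the measure. [this work] -/
theorem excess4_erase_lt₂ (t b : Fin 4 → Finset ι) {e : ι} (hel : e ∈ b 2) (het : e ∉ t 2) (he : e ∈ b 0 ∪ b 1 ∪ b 3) :
    excess4 t (Function.update b 2 ((b 2).erase e)) < excess4 t b := by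
  have n02 : (0 : Fin 4) ≠ 2 := by decide
  have n12 : (1 : Fin 4) ≠ 2 := by decide
  have n32 : (3 : Fin 4) ≠ 2 := by decide
  unfold excess4
  rw [Function.update_self, Function.update_of_ne n02, Function.update_of_ne n12, Function.update_of_ne n32]
  have hs : (b 2).erase e ⊆ b 2 := erase_subset e (b 2)
  have h2 : ((((b 2).erase e) \ t 2) ∩ (b 0 ∪ b 1 ∪ b 3)).card < ((b 2 \ t 2) ∩ (b 0 ∪ b 1 ∪ b 3)).card := by
    apply card_lt_card
    refine ⟨inter_subset_inter (sdiff_subset_sdiff hs subset_rfl) subset_rfl, fun hcon => ?_⟩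
    have hmem : e ∈ (b 2 \ t 2) ∩ (b 0 ∪ b 1 ∪ b 3) := mem_inter.2 ⟨mem_sdiff.2 ⟨hel, het⟩, he⟩
    have := mem_inter.1 (hcon hmem)
    exact ((mem_erase.1 (mem_sdiff.1 this.1).1).1) rfl
  have h0 : ((b 0 \ t 0) ∩ (b 1 ∪ (b 2).erase e ∪ b 3)).card ≤ ((b 0 \ t 0) ∩ (b 1 ∪ b 2 ∪ b 3)).card :=
    card_le_card (inter_subset_inter subset_rfl (union_subset_union (union_subset_union subset_rfl hs) subset_rfl))
  have h1 : ((b 1 \ t 1) ∩ (b 0 ∪ (b 2).erase e ∪ b 3)).card ≤ ((b 1 \ t 1) ∩ (b 0 ∪ b 2 ∪ b 3)).card :=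
    card_le_card (inter_subset_inter subset_rfl (union_subset_union (union_subset_union subset_rfl hs) subset_rfl))
  have h3 : ((b 3 \ t 3) ∩ (b 0 ∪ b 1 ∪ (b 2).erase e)).card ≤ ((b 3 \ t 3) ∩ (b 0 ∪ b 1 ∪ b 2)).card :=
    card_le_card (inter_subset_inter subset_rfl (union_subset_union (union_subset_union subset_rfl subset_rfl) hs))
  omega

omit [Fintype ι] in
/-- Erasing a removable coordinate from `b 3` decreases the measure. [this work] -/
theorem excess4_erase_lt₃ (t b : Fin 4 → Finset ι) {e : ι} (hel : e ∈ b 3) (het : e ∉ t 3) (he : e ∈ b 0 ∪ b 1 ∪ b 2) :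
    excess4 t (Function.update b 3 ((b 3).erase e)) < excess4 t b := by
  have n03 : (0 : Fin 4) ≠ 3 := by decide
  have n13 : (1 : Fin 4) ≠ 3 := by decide
  have n23 : (2 : Fin 4) ≠ 3 := by decide
  unfold excess4
  rw [Function.update_self, Function.update_of_ne n03, Function.update_of_ne n13, Function.update_of_ne n23]
  have hs : (b 3).erase e ⊆ b 3 := erase_subset e (b 3)
  have h3 : ((((b 3).erase e) \ t 3) ∩ (b 0 ∪ b 1 ∪ b 2)).card < ((b 3 \ t 3) ∩ (b 0 ∪ b 1 ∪ b 2)).card := by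
    apply card_lt_card
    refine ⟨inter_subset_inter (sdiff_subset_sdiff hs subset_rfl) subset_rfl, fun hcon => ?_⟩
    have hmem : e ∈ (b 3 \ t 3) ∩ (b 0 ∪ b 1 ∪ b 2) := mem_inter.2 ⟨mem_sdiff.2 ⟨hel, het⟩, he⟩
    have := mem_inter.1 (hcon hmem)
    exact ((mem_erase.1 (mem_sdiff.1 this.1).1).1) rfl
  have h0 : ((b 0 \ t 0) ∩ (b 1 ∪ b 2 ∪ (b 3).erase e)).card ≤ ((b 0 \ t 0) ∩ (b 1 ∪ b 2 ∪ b 3)).card :=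
    card_le_card (inter_subset_inter subset_rfl (union_subset_union (union_subset_union subset_rfl subset_rfl) hs))
  have h1 : ((b 1 \ t 1) ∩ (b 0 ∪ b 2 ∪ (b 3).erase e)).card ≤ ((b 1 \ t 1) ∩ (b 0 ∪ b 2 ∪ b 3)).card :=
    card_le_card (inter_subset_inter subset_rfl (union_subset_union (union_subset_union subset_rfl subset_rfl) hs))
  have h2 : ((b 2 \ t 2) ∩ (b 0 ∪ b 1 ∪ (b 3).erase e)).card ≤ ((b 2 \ t 2) ∩ (b 0 ∪ b 1 ∪ b 3)).card :=
    card_le_card (inter_subset_inter subset_rfl (union_subset_union (union_subset_union subset_rfl subset_rfl) hs))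
  omega

omit [Fintype ι] in
/-- Erasing a non-top coordinate keeps `t ⊆ b` (four slots). [this work] -/
theorem subset_update_erase4 {t b : Fin 4 → Finset ι} (htb : ∀ l, t l ⊆ b l) (l : Fin 4) {e : ι} (het : e ∉ t l) :
    ∀ l', t l' ⊆ Function.update b l ((b l).erase e) l' := by
  intro l'
  by_cases hl' : l' = l
  · subst hl'
    rw [Function.update_self]
    intro x hx
    exact mem_erase.2 ⟨fun hxe => het (hxe ▸ hx), htb _ hx⟩
  · rw [Function.update_of_ne hl']; exact htb l'

/-- `Δ₄(s) ≥ 0` for all cylinder pairs, by induction on `excess4` (tops fixed, so the `C₄` hypothesis is carried along). [this work] -/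
theorem D4cyl_nonneg_aux (hp0 : ∀ e, 0 ≤ p e) (hp1 : ∀ e, p e ≤ 1) {s : ℝ} (hs0 : 0 ≤ s) (hs1 : s ≤ 1) (t : Fin 4 → Finset ι)
    (hE4 : 0 ≤ 6 * cylMass p (t 0 ∪ t 1 ∪ t 2 ∪ t 3) - 2 * cylMass p (t 0) * cylMass p (t 1 ∪ t 2 ∪ t 3) - cylMass p (t 0 ∪ t 1) * cylMass p (t 2 ∪ t 3) - 2 * cylMass p (t 1) * cylMass p (t 0 ∪ t 2 ∪ t 3) + cylMass p (t 0) * cylMass p (t 1) * cylMass p (t 2 ∪ t 3) - 2 * cylMass p (t 3) * cylMass p (t 0 ∪ t 1 ∪ t 2) - cylMass p (t 0 ∪ t 3) * cylMass p (t 1 ∪ t 2) + cylMass p (t 0) * cylMass p (t 3) * cylMass p (t 1 ∪ t 2) - cylMass p (t 0 ∪ t 2) * cylMass p (t 1 ∪ t 3) - 2 * cylMass p (t 2) * cylMass p (t 0 ∪ t 1 ∪ t 3) + cylMass p (t 0) * cylMass p (t 2) * cylMass p (t 1 ∪ t 3) + cylMass p (t 2) * cylMass p (t 3) * cylMass p (t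 0 ∪ t 1) + cylMass p (t 1) * cylMass p (t 3) * cylMass p (t 0 ∪ t 2) + cylMass p (t 1) * cylMass p (t 2) * cylMass p (t 0 ∪ t 3) - cylMass p (t 0) * cylMass p (t 1) * cylMass p (t 2) * cylMass p (t 3)) :
    ∀ (n : ℕ) (b : Fin 4 → Finset ι), (∀ l, t l ⊆ b l) → excess4 t b ≤ n → 0 ≤ D4cyl p s t b := by
  intro n
  induction n with
  | zero =>
    intro b htb hex
    have h : excess4 t b = 0 := Nat.le_zero.1 hex
    unfold excess4 at h
    have z0 : ((b 0 \ t 0) ∩ (b 1 ∪ b 2 ∪ b 3)).card = 0 := by omega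
    have z1 : ((b 1 \ t 1) ∩ (b 0 ∪ b 2 ∪ b 3)).card = 0 := by omega
    have z2 : ((b 2 \ t 2) ∩ (b 0 ∪ b 1 ∪ b 3)).card = 0 := by omega
    have z3 : ((b 3 \ t 3) ∩ (b 0 ∪ b 1 ∪ b 2)).card = 0 := by omega
    exact D4cyl_nonneg_of_frozen hp0 hp1 hs0 hs1 htb hE4 (card_eq_zero.1 z0) (card_eq_zero.1 z1) (card_eq_zero.1 z2)
      (card_eq_zero.1 z3)
  | succ n ih =>
    intro b htb hex
    by_cases c0 : ((b 0 \ t 0) ∩ (b 1 ∪ b 2 ∪ b 3)).Nonempty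
    · obtain ⟨e, he⟩ := c0
      rw [mem_inter, mem_sdiff] at he
      have hlt := excess4_erase_lt₀ t b he.1.1 he.1.2 he.2
      exact (ih _ (subset_update_erase4 htb 0 he.1.2) (by omega)).trans
        (D4cyl_erase_le₀ hp0 hp1 hs0 hs1 t b htb he.2)
    by_cases c1 : ((b 1 \ t 1) ∩ (b 0 ∪ b 2 ∪ b 3)).Nonempty
    · obtain ⟨e, he⟩ := c1
      rw [mem_inter, mem_sdiff] at he
      have hlt := excess4_erase_lt₁ t b he.1.1 he.1.2 he.2
      exact (ih _ (subset_update_erase4 htb 1 he.1.2) (by omega)).trans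
        (D4cyl_erase_le₁ hp0 hp1 hs0 hs1 t b htb he.2)
    by_cases c2 : ((b 2 \ t 2) ∩ (b 0 ∪ b 1 ∪ b 3)).Nonempty
    · obtain ⟨e, he⟩ := c2
      rw [mem_inter, mem_sdiff] at he
      have hlt := excess4_erase_lt₂ t b he.1.1 he.1.2 he.2
      exact (ih _ (subset_update_erase4 htb 2 he.1.2) (by omega)).trans
        (D4cyl_erase_le₂ hp0 hp1 hs0 hs1 t b htb he.2)
    by_cases c3 : ((b 3 \ t 3) ∩ (b 0 ∪ b 1 ∪ b 2)).Nonempty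
    · obtain ⟨e, he⟩ := c3
      rw [mem_inter, mem_sdiff] at he
      have hlt := excess4_erase_lt₃ t b he.1.1 he.1.2 he.2
      exact (ih _ (subset_update_erase4 htb 3 he.1.2) (by omega)).trans
        (D4cyl_erase_le₃ hp0 hp1 hs0 hs1 t b htb he.2)
    rw [not_nonempty_iff_eq_empty] at c0 c1 c2 c3
    exact D4cyl_nonneg_of_frozen hp0 hp1 hs0 hs1 htb hE4 c0 c1 c2 c3

/-- **`Δ₄(s) ≥ 0` FOR FOUR CYLINDER PAIRS** on the cube `{0,1}^ι` with any product weight `0 ≤ p ≤ 1` and any `s ∈ [0,1]`, given `E₄ ≥ 0` for the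
four top cylinders (discharged for `bernoulliWeight` in part 3). [this work] -/
theorem D4cyl_nonneg (hp0 : ∀ e, 0 ≤ p e) (hp1 : ∀ e, p e ≤ 1) {s : ℝ} (hs0 : 0 ≤ s) (hs1 : s ≤ 1) {t b : Fin 4 → Finset ι}
    (htb : ∀ l, t l ⊆ b l) (hE4 : 0 ≤ 6 * cylMass p (t 0 ∪ t 1 ∪ t 2 ∪ t 3) - 2 * cylMass p (t 0) * cylMass p (t 1 ∪ t 2 ∪ t 3) - cylMass p (t 0 ∪ t 1) * cylMass p (t 2 ∪ t 3) - 2 * cylMass p (t 1) * cylMass p (t 0 ∪ t 2 ∪ t 3) + cylMass p (t 0) * cylMass p (t 1) * cylMass p (t 2 ∪ t 3) - 2 * cylMass p (t 3) * cylMass p (t 0 ∪ t 1 ∪ t 2) - cylMass p (t 0 ∪ t 3) * cylMass p (t 1 ∪ t 2) + cylMass p (t 0) * cylMass p (t 3) * cylMass p (t 1 ∪ t 2) - cylMass p (t 0 ∪ t 2) * cylMass p (t 1 ∪ t 3) - 2 * cylMass p (t 2) * cylMass p (t 0 ∪ t 1 ∪ t 3) + cylMass p (t 0) * cylMass p (t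 2) * cylMass p (t 1 ∪ t 3) + cylMass p (t 2) * cylMass p (t 3) * cylMass p (t 0 ∪ t 1) + cylMass p (t 1) * cylMass p (t 3) * cylMass p (t 0 ∪ t 2) + cylMass p (t 1) * cylMass p (t 2) * cylMass p (t 0 ∪ t 3) - cylMass p (t 0) * cylMass p (t 1) * cylMass p (t 2) * cylMass p (t 3)) :
    0 ≤ D4cyl p s t b :=
  D4cyl_nonneg_aux hp0 hp1 hs0 hs1 t hE4 (excess4 t b) b htb le_rfl

end

end Summit.CriticalPhenomena.PercolationContinuityZ3.Theorems.SahiTangentCyl
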